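import Literature.NumberTheory.ConnesConsani2021.ArchKernelL1AdditivePanels
import Literature.NumberTheory.ConnesConsani2021.ProlateEigenvalueMomentDecay
import Literature.NumberTheory.ConnesConsani2021.ProlateEigenvalueExplicitDecayNumerics
import Literature.NumberTheory.ConnesConsani2021.ArchKernelModeIdentification
import Literature.NumberTheory.ConnesConsani2021.EpsSlopeFrobeniusBridge
import Literature.NumberTheory.ConnesConsani2021.EpsSlopeFrobeniusToolkit
import Mathlib.Analysis.Complex.ExponentialBounds
import HarnessLib

/-!
# The (E-a) enclosure from the three Tier-2 read-backs (assembly frame with the literature inputs discharged)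

RH-FREE corpus literature (label, line 1): bookkeeping — the uniform additive-scale frame
`section6_enclosures_of_uniformVpanels_of_majorant_rat` (`ArchKernelL1AdditivePanels.lean`) with
every input that the TREE already proves plugged in: the hybrid tail majorant of seat t6
(`ProlateEigenvalueMomentDecay.lean`: `|λ(n)| ≤ 4(4π²)ⁿ/(n!)²` beyond the block, far tail `≤ 1/2500`),
the bound `‖τ_c‖ ≤ 6` on the certificate kernel (`norm_frameKernel_le` + the rational table `CertAF.c`),
`log 2 ≤ 0.6931471808` (Mathlib).  Nothing in this file mentions `ζ`, the critical strip or RH, and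
nothing here bears on the truth of RH.  bears_on (cell rh-crit, corpus C1): apex input (C) — route
«ConnesConsaniSemilocal» item K3 `WindowSpectralBound` (stmt 19306).

Also here: `prolateFun_eq_frobEvenExt_of_strictMono` / `exists_critical_prolateFun_eq_frobEvenExt` —
the certified thin `χ`-brackets (sign change of `u′_χ(0)`, ordered, capped by `272`) identify the
members `ψ_0, …, ψ_7` with normalised Frobenius solutions, the hypothesis of the (99)→Frobenius
read-back `ArchKernelSonineFrobenius.sonineQTerm_prolateFun_eq_frob`.

The high-mode tail (`n ≥ 8`) is discharged HERE from the tree: the block `8 ≤ n < 24` by seat t15's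
explicit majorant (`ProlateEigenvalueExplicitDecayNumerics.lean`: `|λ(n)| ≤ R(n) ≤ 13/200`,
`Σ_{8≤n<24} R(n)·4πp(n) ≤ 1/1000`), the far tail by seat t6's moment bound
(`ProlateEigenvalueMomentDecay.lean`: `4(4π²)ⁿ/(n!)²`, `Σ_{n≥24} ≤ 1/2500`), i.e. `T = 7/5000`
(t15's four-instance recipe, cell board 12:25:00Z; t6 12:32:47Z).  After this file the named fact
`CC2021_section6_enclosures` follows from EXACTLY two kernel read-backs (cell rulings R110–R116,
2026-08-26; seats cc-eng-1 g2 / cc-iso g4 / gm-t16 g2): (K1/T2e) a rational slope enclosure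
`e⁻ ≤ Σ' t(n) ≤ e⁺`; (T2b/T2d) rational per-panel bounds `M_k`, `k < m`, of
`|2ẽ·Re τ_c(w) − Σ_{n<8} τ(n)T_n(e^w)|` on the uniform panels `[k·log 2/m, (k+1)·log 2/m]` — plus one
decidable rational inequality.  It proves neither of those two.

Source: A. Connes, C. Consani, *Weil positivity and trace formula, the archimedean place*, Selecta
Math. (N.S.) 27 (2021) 77 = arXiv:2006.13771 [bib `ConnesConsani2021`], §6.3–6.4 p. 24 (Fact 6.1,
Lemma 6.3), §5 eq. (101) p. 33, App. F Lemma F.1 (arXiv Lemma 49) p. 55.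

WHAT THIS FILE IS NOT: a certificate, a discharge of (E-a), or anything about RH.
-/

noncomputable section

open Real Set MeasureTheory Filter Topology

namespace Literature.NumberTheory.ConnesConsani2021

open Literature.NumberTheory.LFunctions

/-! ## Identification of the certified members from their brackets -/

/-- RH-FREE. **Identification from certified critical parameters**: if
`b_0 < b_1 < … < b_{N−1} < 2N(2N+1)` are critical (`u′_{b_j}(0) = 0`), then `ψ_j = frobEvenExt b_j`
for every `j < N` — the hypothesis of the (99)→Frobenius identities
(`ArchKernelSonineFrobenius.sonineQTerm_prolateFun_eq_frob`), with NO zero counting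
(`eq_prolateFun_of_exists_index_of_eigen_strictMono` at `u_j := frobEvenExt b_j`, `χ_j := b_j`).
[cite: ConnesConsani2021, §4 p. 16 (arXiv p0016:L17–L36); WangLL2010, Lemma 2.2; SlepianPollak1961, §III] -/
theorem prolateFun_eq_frobEvenExt_of_strictMono {N : ℕ} {b : ℕ → ℝ}
    (hcrit : ∀ j < N, frobSol₁ 1 (b j) 0 = 0) (hmono : ∀ j, j + 1 < N → b j < b (j + 1))
    (htop : ∀ j < N, b j < 2 * (N : ℝ) * (2 * N + 1)) :
    ∀ j < N, prolateFun j = frobEvenExt (b j) := by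
  have h := eq_prolateFun_of_exists_index_of_eigen_strictMono (N := N)
    (u := fun j ↦ frobEvenExt (b j)) (χ := b)
    (fun j hj ↦ ⟨_, (isProlateFunction_frobEvenExt (hcrit j hj) rfl).1⟩)
    (fun j hj ↦ (isProlateFunction_frobEvenExt (hcrit j hj) rfl).2) hmono htop
  intro j hj
  exact (h j hj).symm

/-- RH-FREE. **Identification from certified brackets**: thin brackets `[lo_j, hi_j]`, `j < N`, each
with a certified sign change of the shooting value `u′_χ(0)` (either orientation — the kernel's
`bracketOK`), pairwise ordered (`hi_j < lo_{j+1}`) and capped (`hi_j < 2N(2N+1)`), contain critical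
parameters `b_j` with `ψ_j = frobEvenExt b_j` for every `j < N` (IVT `exists_critical_of_sign_change`
+ `prolateFun_eq_frobEvenExt_of_strictMono`).  For the (E-a) certificate: `N = 8`, cap `272`.
[cite: ConnesConsani2021, §4 p. 16 (arXiv p0016:L17–L36); CoddingtonLevinson1955, Ch. 8 §2 Thm 2.1; WangLL2010, Lemma 2.2] -/
theorem exists_critical_prolateFun_eq_frobEvenExt {N : ℕ} {lo hi : ℕ → ℝ}
    (hle : ∀ j < N, lo j ≤ hi j)
    (hsign : ∀ j < N, (frobSol₁ 1 (lo j) 0 ≤ 0 ∧ 0 ≤ frobSol₁ 1 (hi j) 0) ∨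
      (0 ≤ frobSol₁ 1 (lo j) 0 ∧ frobSol₁ 1 (hi j) 0 ≤ 0))
    (hsep : ∀ j, j + 1 < N → hi j < lo (j + 1))
    (htop : ∀ j < N, hi j < 2 * (N : ℝ) * (2 * N + 1)) :
    ∃ b : ℕ → ℝ, ∀ j < N, b j ∈ Icc (lo j) (hi j) ∧ frobSol₁ 1 (b j) 0 = 0 ∧
      prolateFun j = frobEvenExt (b j) := by
  classical
  -- a critical parameter in each bracket
  have hex : ∀ j < N, ∃ b ∈ Icc (lo j) (hi j), frobSol₁ 1 b 0 = 0 := by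
    intro j hj
    rcases hsign j hj with ⟨h1, h2⟩ | ⟨h1, h2⟩
    · exact exists_critical_of_sign_change (hle j hj) h1 h2
    · exact exists_critical_of_sign_change' (hle j hj) h1 h2
  let b : ℕ → ℝ := fun j ↦ if hj : j < N then (hex j hj).choose else 0
  have hb : ∀ j < N, b j ∈ Icc (lo j) (hi j) ∧ frobSol₁ 1 (b j) 0 = 0 := by
    intro j hj
    simp only [b, dif_pos hj]
    exact (hex j hj).choose_spec
  refine ⟨b, fun j hj ↦ ⟨(hb j hj).1, (hb j hj).2, ?_⟩⟩
  refine prolateFun_eq_frobEvenExt_of_strictMono (fun i hi ↦ (hb i hi).2) (fun i hi ↦ ?_)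
    (fun i hi ↦ lt_of_le_of_lt (hb i hi).1.2 (htop i hi)) j hj
  exact lt_of_le_of_lt (hb i (by omega)).1.2 (lt_of_lt_of_le (hsep i hi) (hb (i + 1) hi).1.1)

/-! ## `‖τ_c‖ ≤ 6` -/

/-- The absolute row sum of the certificate's kernel coefficients over the symmetric window:
`Σ_{|n| ≤ 100} |c_{|n|}| ≤ 393/100` (exact rational data, decided in the kernel).
[cite: ConnesConsani2021, §6.4 display (opkf1) p. 24; certificate data cc/engine cert-AF.json sha16 c9b33fffc99c81ac] -/
theorem SpectralCert.CertAF.sum_abs_c_le :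
    (∑ n ∈ Finset.Icc (-(100 : ℤ)) 100, |SpectralCert.CertAF.c n.natAbs|) ≤ (393 / 100 : ℚ) := by
  decide +kernel

/-- RH-FREE. **`‖τ_c(v)‖ ≤ 6`** for the certificate kernel on the window `L = log 2`
(`‖τ_c‖ ≤ L⁻¹ Σ_{|n|≤N} |c_{|n|}| ≤ 3.93/0.6931 < 6`).
[cite: ConnesConsani2021, §6.4 display (opkf1) p. 24] -/
theorem SpectralCert.norm_frameKernel_certAF_le (v : ℝ) :
    ‖SpectralCert.frameKernel (-(Real.log 2 / 2)) (Real.log 2 / 2) SpectralCert.CertAF.N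
        (fun n ↦ (SpectralCert.CertAF.c n : ℝ)) v‖ ≤ ((6 : ℚ) : ℝ) := by
  have h := SpectralCert.norm_frameKernel_le (-(Real.log 2 / 2)) (Real.log 2 / 2)
    SpectralCert.CertAF.N (fun n ↦ (SpectralCert.CertAF.c n : ℝ)) v
  have hL : Real.log 2 / 2 - -(Real.log 2 / 2) = Real.log 2 := by ring
  rw [hL] at h
  have hlog : 0.6931471803 < Real.log 2 := Real.log_two_gt_d9
  have hlog0 : 0 < Real.log 2 := by linarith
  have hinv : |(Real.log 2)⁻¹| ≤ 1 / 0.6931471803 := by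
    rw [abs_of_pos (inv_pos.2 hlog0), one_div]
    exact (inv_le_inv₀ hlog0 (by norm_num)).2 hlog.le
  have hsum : ∑ n ∈ Finset.Icc (-(SpectralCert.CertAF.N : ℤ)) SpectralCert.CertAF.N,
      |((SpectralCert.CertAF.c n.natAbs : ℚ) : ℝ)| ≤ 393 / 100 := by
    have h1 := SpectralCert.CertAF.sum_abs_c_le
    have h2 : ((∑ n ∈ Finset.Icc (-(100 : ℤ)) 100, |SpectralCert.CertAF.c n.natAbs| : ℚ) : ℝ)
        ≤ ((393 / 100 : ℚ) : ℝ) := by exact_mod_cast h1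
    push_cast at h2
    exact h2
  have hs0 : 0 ≤ ∑ n ∈ Finset.Icc (-(SpectralCert.CertAF.N : ℤ)) SpectralCert.CertAF.N,
      |((SpectralCert.CertAF.c n.natAbs : ℚ) : ℝ)| := Finset.sum_nonneg fun _ _ ↦ abs_nonneg _
  refine h.trans ?_
  calc |(Real.log 2)⁻¹| * ∑ n ∈ Finset.Icc (-(SpectralCert.CertAF.N : ℤ)) SpectralCert.CertAF.N,
          |((SpectralCert.CertAF.c n.natAbs : ℚ) : ℝ)|
      ≤ (1 / 0.6931471803) * (393 / 100) := mul_le_mul hinv hsum hs0 (by norm_num)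
    _ ≤ ((6 : ℚ) : ℝ) := by norm_num

/-! ## The assembly -/

/-- RH-FREE. **`CC2021_section6_enclosures` from the two head read-backs.**  Inputs (all rational
data): a slope enclosure `e⁻ ≤ Σ' t(n) ≤ e⁺` with a representative `ẽ ∈ [e⁻, e⁺]` (K1/T2e), per-panel
bounds `M_k` of `|2ẽ·Re τ_c(w) − Σ_{n<8} τ(n)T_n(e^w)|` on the `m` uniform additive panels of
`[0, log 2]` (T2b/T2d), and the decidable check
`0.6931471808 · e⁻⁻¹ · ((Σ_{k<m} M_k)/m + 12(e⁺−e⁻) + 7/5000) ≤ 1/400`.  Supplied here from the tree: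
the whole tail `n ≥ 8` (`N₁ = 8`, block majorant of seat t15 + far moment tail of seat t6,
`T = 1/1000 + 1/2500`), `‖τ_c‖ ≤ 6`, `log 2 ≤ 0.6931471808`.
[cite: ConnesConsani2021, §6.4 Fact 6.1 + Lemma 6.3 p. 24; §5 eq. (101) p. 33; App. F Lemma F.1 (arXiv Lemma 49) p. 55; §6.7 Lemma 6.10 / Thm. 6.11 p. 28] -/
theorem section6_enclosures_of_tier2 {elo ehi et : ℚ} {m : ℕ} {M : ℕ → ℚ}
    (helo : 0 < elo)
    (he : (elo : ℝ) ≤ ∑' n : ℕ, epsSlopeTerm (prolateFun n) ∧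
      ∑' n : ℕ, epsSlopeTerm (prolateFun n) ≤ (ehi : ℝ))
    (het : elo ≤ et ∧ et ≤ ehi) (hm : 0 < m)
    (hM : ∀ k < m, ∀ w ∈ Icc ((k : ℝ) * Real.log 2 / m) (((k + 1 : ℕ) : ℝ) * Real.log 2 / m),
      |2 * (et : ℝ) * (SpectralCert.frameKernel (-(Real.log 2 / 2)) (Real.log 2 / 2)
            SpectralCert.CertAF.N (fun n ↦ (SpectralCert.CertAF.c n : ℝ)) w).re
        - ∑ n ∈ Finset.range 8, sonineQTerm (prolateFun n) (prolateEigen n) (Real.exp w)|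
        ≤ (M k : ℝ))
    (hcheck : (6931471808 / 10 ^ 10 : ℚ) * ((1 / elo) * ((∑ k ∈ Finset.range m, M k) / m
        + (2 * (ehi - elo) * 6 + 7 / 5000))) ≤ SpectralCert.CertAF.ε₁) :
    CC2021_section6_enclosures := by
  -- the hybrid majorant: seat t15's explicit `R` on the block `8 ≤ n < 24`, seat t6's `4(4π²)ⁿ/(n!)²` beyond
  set Rh : ℕ → ℝ := fun n ↦
    if n < 24 then prolateEigenMajorant n else 4 * (4 * π ^ 2) ^ n / (n.factorial : ℝ) ^ 2 with hRh
  have hR : ∀ n, 8 ≤ n → |prolateEigen n| ≤ Rh n := fun n hn ↦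
    abs_prolateEigen_le_hybrid (R := prolateEigenMajorant)
      (fun _ h8 _ ↦ abs_prolateEigen_le_prolateEigenMajorant h8) n hn
  have hR' : ∀ n, 8 ≤ n → Rh n ≤ 13 / 200 := fun n hn ↦
    hybrid_le (R := prolateEigenMajorant) (fun _ h8 h24 ↦ prolateEigenMajorant_le_of_mem_Ico h8 h24) n hn
  have hRs : Summable (fun n ↦ Rh n * remainderPoly n) :=
    summable_hybrid_mul_remainderPoly prolateEigenMajorant
  have hRT : ∑' k : ℕ, Rh (k + 8) * (4 * π * remainderPoly (k + 8)) ≤ ((7 / 5000 : ℚ) : ℝ) := by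
    have h := tsum_hybrid_le (R := prolateEigenMajorant) sum_Ico_prolateEigenMajorant_mul_le
    refine (le_of_eq ?_).trans (h.trans (by norm_num))
    rfl
  have hL : Real.log 2 ≤ ((6931471808 / 10 ^ 10 : ℚ) : ℝ) := by
    have h := Real.log_two_lt_d9
    push_cast
    linarith
  exact section6_enclosures_of_uniformVpanels_of_majorant_rat (N₁ := 8) (by norm_num) hR hR' hRs hRT
    SpectralCert.norm_frameKernel_certAF_le helo he het hm hM hL hcheck

/-- RH-FREE. **Primed variant with the binder shape `((k : ℝ) + 1) * log 2 / m`** for the upper panel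
endpoint (the T2d read-back's natural output); otherwise identical to `section6_enclosures_of_tier2`.
[cite: ConnesConsani2021, §6.4 Fact 6.1 + Lemma 6.3 p. 24; §5 eq. (101) p. 33] -/
theorem section6_enclosures_of_tier2' {elo ehi et : ℚ} {m : ℕ} {M : ℕ → ℚ}
    (helo : 0 < elo)
    (he : (elo : ℝ) ≤ ∑' n : ℕ, epsSlopeTerm (prolateFun n) ∧
      ∑' n : ℕ, epsSlopeTerm (prolateFun n) ≤ (ehi : ℝ))
    (het : elo ≤ et ∧ et ≤ ehi) (hm : 0 < m)
    (hM : ∀ k < m, ∀ w ∈ Icc ((k : ℝ) * Real.log 2 / m) (((k : ℝ) + 1) * Real.log 2 / m),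
      |2 * (et : ℝ) * (SpectralCert.frameKernel (-(Real.log 2 / 2)) (Real.log 2 / 2)
            SpectralCert.CertAF.N (fun n ↦ (SpectralCert.CertAF.c n : ℝ)) w).re
        - ∑ n ∈ Finset.range 8, sonineQTerm (prolateFun n) (prolateEigen n) (Real.exp w)|
        ≤ (M k : ℝ))
    (hcheck : (6931471808 / 10 ^ 10 : ℚ) * ((1 / elo) * ((∑ k ∈ Finset.range m, M k) / m
        + (2 * (ehi - elo) * 6 + 7 / 5000))) ≤ SpectralCert.CertAF.ε₁) :
    CC2021_section6_enclosures :=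
  section6_enclosures_of_tier2 helo he het hm
    (fun k hk w hw ↦ hM k hk w (by simpa only [Nat.cast_add, Nat.cast_one] using hw)) hcheck

end Literature.NumberTheory.ConnesConsani2021

end
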